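import Summits.BirchSwinnertonDyer.BirchSwinnertonDyer.Theorems.ResidualThetaTransportAtTwoPlusDualFreeRankOne
import Summits.BirchSwinnertonDyer.BirchSwinnertonDyer.Theorems.ResidualThetaTransportAtTwoPlusModTwoInvariantsOfHonda
import Summits.BirchSwinnertonDyer.BirchSwinnertonDyer.Theorems.ResidualThetaTransportAtTwoPlusRankGrowthTwo
import HarnessLib

/-!
# Input (R1) of road T / road Λ to item 23110 ASSEMBLED: `(H⁺)^∨ ≅ Λ` at `2` — for EVERY realization `S` of
# `(⋃ₙ E⁺(ℚ_{2,n})) ⊗ ℚ₂/ℤ₂` (maps `ι_k : A → S`, «`x ⊗ 2^{-k}`», with the five evident axioms) and EVERY dual pair `(X, toDual)`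
# of `(S, conj_g − 1)`, `X ≃ₗ[ℤ₂⟦T⟧] ℤ₂⟦T⟧` — UNCONDITIONALLY for `W/ℚ` globally minimal, `GoodSS W 2`, `a₂ = 0`

Routes `ResidualThetaTransportAtTwo` (RTT, crux r201 `ResidualLambdaFormulaNegDiscAtTwo`, stmt-BirchSwinnertonDyer-23110) /
`ThetaPartnerAtTwo`. Seat `prover-bsd-wall-tp2-p2x-w2` g15; `--supports stmt-BirchSwinnertonDyer-23110`. THEOREMS ONLY (no definition,
no named fact, no `sorry`); closes nothing.

WHY (lead memo RLF-TWIST-ROAD-g12 §3 (R1) = B. D. Kim, Compositio 143 (2007) Prop. 3.17 at the prime `2`, «NOT print at 2 — a kernel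
target»). The three bricks are in the tree: the dual-side algebra `PlusDual.nonempty_linearEquiv_of_generator_of_divisible_of_infinite`
(p658902), the point-level inputs `PlusModP.plusFixedModTwo_dep_iSup_two` (`(A/2A)^γ` pairwise dependent, from CYC⁺) and
`PlusRankGrowth.not_exists_finset_cover_mod_two` (`A/2A` infinite, from `Col⁺` onto), `A = ⋃ₙ E⁺(ℚ_{2,n})`. THIS FILE glues them
through an ABSTRACT realization of `A ⊗ ℚ_p/ℤ_p`: additive maps `ι k : A → S` («`x ↦ x ⊗ p^{-k}`») with `ι 0 = 0`,
`p·ι_{k+1} = ι_k`, `S = ⋃ im ι_k`, `ker ι_k = p^k A`, and `φ ∘ ι_k = ι_k ∘ γ` — satisfied by the Kummer realization inside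
`H¹(ℚ_{∞,2}, E[2^∞])` (Kummer injectivity + saturation of `A` in the tower) and by any algebraic model of the tensor product:

* §1 `exists_generator_of_pairwise_dep` — in a `p`-torsion situation, pairwise dependence of `S[𝔪]` gives ONE generator
  (`S[𝔪] ⊆ ℕ·e`); `nonempty_linearEquiv_of_pairwise_dep_of_divisible_of_infinite` — the dual algebra in pairwise currency.
* §2 `nonempty_linearEquiv_of_hull` — ABSTRACT BRIDGE (any `p`, any `L ≥ A`, any `γ : L → L`): realization axioms + the two
  point-level inputs (pairwise dependence of the `γ`-fixed classes of `A/pA`; no finite cover of `A` mod `p`) ⟹ `X ≃ₗ[Λ] Λ` for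
  every dual pair of `(S, φ − 1)`.
* §3 **`nonempty_linearEquiv_iwasawaAlgebra_two`** — `K = ℚ`, `p = 2`, `A = ⋃ₙ E⁺(ℚ_{2,n})`, `γ = g` a local lift of the
  topological generator: UNCONDITIONAL for `GoodSS W 2`, `a₂(W) = 0`.

HONEST FRAMING: the realization axioms are displayed hypotheses (the tree has no tensor-product object for `A ⊗ ℚ₂/ℤ₂`); closes
nothing; 23110 is NOT proved; BSD is not proved by any of this.
References: [BDKim2007] Prop. 3.17; [BDKim2013] Props. 2.2–2.3; [Kobayashi2003] Thm. 6.2, Prop. 8.12, Prop. 8.23; [GreenbergLNM1716] §1.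
-/

set_option autoImplicit false
-- D-0017: single-problem summit, so `Summit.BirchSwinnertonDyer.BirchSwinnertonDyer.…` repeats a namespace BY DESIGN.
set_option linter.dupNamespace false

noncomputable section

open scoped Classical NumberField
open Literature.NumberTheory.EllipticCurves Literature.NumberTheory.EllipticCurves.IwasawaDual

namespace Summit.BirchSwinnertonDyer.BirchSwinnertonDyer.Theorems.ResidualThetaLayer.PlusDual

/-! ## §1 Pairwise dependence ⟹ one generator -/

section Pairwise

variable {p : ℕ} [Fact p.Prime]
variable {S : Type*} [AddCommGroup S] {ψ : AddMonoid.End S}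
variable {X : Type*} [AddCommGroup X] [Module (PowerSeries ℤ_[p]) X]
variable {toDual : X →+ (S →+ AddCircle (1 : ℚ))}

/-- **Pairwise dependent `p`-torsion elements lie in the multiples of one of them.** If every two elements of
`S[𝔪] = {s : p s = 0 ∧ ψ s = 0}` satisfy `a s + b t = 0` with `a, b` not both divisible by `p`, then `S[𝔪] ⊆ ℕ·e` for some
`e ∈ S[𝔪]` (any non-zero `e`; Bézout inverts `a` modulo `p`). [folklore] -/
theorem exists_generator_of_pairwise_dep
    (hdep : ∀ s t : S, p • s = 0 → ψ s = 0 → p • t = 0 → ψ t = 0 →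
      ∃ a b : ℤ, ¬ ((p : ℤ) ∣ a ∧ (p : ℤ) ∣ b) ∧ a • s + b • t = 0) :
    ∃ e : S, p • e = 0 ∧ ∀ s : S, p • s = 0 → ψ s = 0 → ∃ k : ℕ, s = k • e := by
  have hp : p.Prime := Fact.out
  have hpZ : Prime (p : ℤ) := Nat.prime_iff_prime_int.mp hp
  -- Bézout: `p ∤ a ⟹ u a + v p = 1`
  have hinv : ∀ a : ℤ, ¬ (p : ℤ) ∣ a → ∃ u : ℤ, ∀ s : S, p • s = 0 → u • a • s = s := by
    intro a ha
    obtain ⟨u, v, huv⟩ := (hpZ.irreducible.coprime_iff_not_dvd.mpr ha).symm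
    refine ⟨u, fun s hs ↦ ?_⟩
    have e : u • a • s = (u * a + v * p) • s := by
      rw [add_zsmul, mul_zsmul, mul_zsmul, natCast_zsmul, hs, zsmul_zero, add_zero]
    rw [e, huv, one_zsmul]
  by_cases hex : ∃ e : S, p • e = 0 ∧ ψ e = 0 ∧ e ≠ 0
  · obtain ⟨e, hpe, hψe, he0⟩ := hex
    refine ⟨e, hpe, fun s hps hψs ↦ ?_⟩
    obtain ⟨a, b, hab, hrel⟩ := hdep s e hps hψs hpe hψe
    by_cases ha : (p : ℤ) ∣ a
    · -- then `b e = 0` with `p ∤ b`, so `e = 0`: contradiction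
      exfalso
      have hb : ¬ (p : ℤ) ∣ b := fun hb ↦ hab ⟨ha, hb⟩
      obtain ⟨c, rfl⟩ := ha
      rw [mul_comm, mul_zsmul, natCast_zsmul, hps, zsmul_zero, zero_add] at hrel
      obtain ⟨u, hu⟩ := hinv b hb
      exact he0 (by rw [← hu e hpe, hrel, zsmul_zero])
    · obtain ⟨u, hu⟩ := hinv a ha
      -- `s = u a s = −u b e`
      have hs : s = (-(u * b)) • e := by
        rw [← hu s hps, ← mul_zsmul, neg_zsmul, eq_neg_iff_add_eq_zero, mul_zsmul, mul_zsmul, ← zsmul_add, hrel, zsmul_zero]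
      refine ⟨((-(u * b)) % (p : ℤ)).toNat, ?_⟩
      have hnn : 0 ≤ (-(u * b)) % (p : ℤ) := Int.emod_nonneg _ (by exact_mod_cast hp.ne_zero)
      rw [hs, ← natCast_zsmul, Int.toNat_of_nonneg hnn]
      conv_lhs => rw [← Int.emod_add_mul_ediv (-(u * b)) p, add_zsmul, mul_comm (p : ℤ), mul_zsmul, natCast_zsmul, hpe,
        zsmul_zero, add_zero]
  · refine ⟨0, smul_zero _, fun s hps hψs ↦ ⟨0, ?_⟩⟩
    by_contra hs
    exact hex ⟨s, hps, hψs, fun h ↦ hs (by rw [h, zero_smul])⟩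

/-- **The dual algebra in pairwise currency**: a dual pair `(X, toDual)` of `(S, ψ)` with `S[𝔪]` pairwise dependent, `S` `p`-divisible
and `S[p]` infinite has `X ≃ₗ[Λ] Λ`. [cite: BDKim2007, Prop. 3.17] [cite: Washington1997, §13.2] -/
theorem nonempty_linearEquiv_of_pairwise_dep_of_divisible_of_infinite (h : IsDualPair p ψ toDual)
    (hdep : ∀ s t : S, p • s = 0 → ψ s = 0 → p • t = 0 → ψ t = 0 →
      ∃ a b : ℤ, ¬ ((p : ℤ) ∣ a ∧ (p : ℤ) ∣ b) ∧ a • s + b • t = 0)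
    (hdiv : ∀ s : S, ∃ t : S, p • t = s) (hinf : {s : S | p • s = 0}.Infinite) :
    Nonempty (X ≃ₗ[PowerSeries ℤ_[p]] PowerSeries ℤ_[p]) := by
  obtain ⟨e, he, hcyc⟩ := exists_generator_of_pairwise_dep (ψ := ψ) hdep
  exact nonempty_linearEquiv_of_generator_of_divisible_of_infinite h he hcyc hdiv hinf

end Pairwise

/-! ## §2 The abstract bridge from points -/

section Hull

variable {p : ℕ} [Fact p.Prime]
variable {L : Type*} [AddCommGroup L] {A : AddSubgroup L} {γ : L → L}
variable {S : Type*} [AddCommGroup S] {φ : AddMonoid.End S}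
variable {X : Type*} [AddCommGroup X] [Module (PowerSeries ℤ_[p]) X]
variable {toDual : X →+ (S →+ AddCircle (1 : ℚ))}

/-- **ABSTRACT BRIDGE: `(A ⊗ ℚ_p/ℤ_p)^∨ ≅ Λ` from two point-level facts.** Let `A ≤ L` be a subgroup stable under a map `γ`, and
let `S` (with an endomorphism `φ`) be a REALIZATION of `A ⊗ ℚ_p/ℤ_p`: additive `ι k : A → S` with `ι 0 = 0`, `p·ι (k+1) x = ι k x`,
every `s` some `ι k x`, `ι k x = 0 ⟹ x ∈ p^k A`, and `φ (ι k x) = ι k (γ x)`. If the `γ`-fixed classes of `A/pA` are pairwise dependent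
and `A` has no finite set of representatives modulo `p`, then every dual pair `(X, toDual)` of `(S, φ − 1)` has `X ≃ₗ[Λ] Λ`.
[cite: BDKim2007, Prop. 3.17] [cite: BDKim2013, Props. 2.2–2.3] -/
theorem nonempty_linearEquiv_of_hull (h : IsDualPair p (φ - 1) toDual) (hγA : ∀ x ∈ A, γ x ∈ A)
    (ι : ℕ → (A →+ S)) (h0 : ∀ x : A, ι 0 x = 0) (hsucc : ∀ (k : ℕ) (x : A), p • ι (k + 1) x = ι k x)
    (hsurj : ∀ s : S, ∃ (k : ℕ) (x : A), ι k x = s)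
    (hker : ∀ (k : ℕ) (x : A), ι k x = 0 → ∃ w : A, (x : L) = p ^ k • (w : L))
    (hequiv : ∀ (k : ℕ) (x : A), φ (ι k x) = ι k ⟨γ x, hγA x x.2⟩)
    (hdep : ∀ x ∈ A, ∀ y ∈ A, (∃ w ∈ A, γ x - x = p • w) → (∃ w ∈ A, γ y - y = p • w) →
      ∃ a b : ℤ, ¬ ((p : ℤ) ∣ a ∧ (p : ℤ) ∣ b) ∧ ∃ w ∈ A, a • x + b • y = p • w)
    (hinf : ¬ ∃ F : Finset L, ∀ x ∈ A, ∃ r ∈ F, ∃ w ∈ A, x = r + p • w) :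
    Nonempty (X ≃ₗ[PowerSeries ℤ_[p]] PowerSeries ℤ_[p]) := by
  have hp : p.Prime := Fact.out
  -- `ι (k+1) (p^k • x) = ι 1 x`
  have hshift : ∀ (k : ℕ) (x : A), ι (k + 1) (p ^ k • x) = ι 1 x := by
    intro k
    induction k with
    | zero => intro x; rw [pow_zero, one_smul]
    | succ k ih => intro x; rw [pow_succ', mul_smul, map_nsmul, hsucc, ← ih x]
  -- `ι 1` kills exactly `pA` and `p • ι 1 = 0`
  have hp1 : ∀ x : A, p • ι 1 x = 0 := fun x ↦ by rw [hsucc 0 x, h0]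
  have hker1 : ∀ x : A, ι 1 x = 0 ↔ ∃ w : A, (x : L) = p • (w : L) := by
    intro x
    refine ⟨fun hx ↦ by simpa using hker 1 x hx, fun ⟨w, hw⟩ ↦ ?_⟩
    have : x = p • w := Subtype.ext (by rw [hw, AddSubgroup.coe_nsmul])
    rw [this, map_nsmul, hp1]
  -- `S[p] = ι 1 (A)`
  have hS1 : ∀ s : S, p • s = 0 → ∃ x : A, ι 1 x = s := by
    intro s hs
    obtain ⟨k, x, rfl⟩ := hsurj s
    cases k with
    | zero => exact ⟨0, by rw [map_zero, h0]⟩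
    | succ j =>
      rw [hsucc] at hs
      obtain ⟨w, hw⟩ := hker j x hs
      have : x = p ^ j • w := Subtype.ext (by rw [hw, AddSubgroup.coe_nsmul])
      exact ⟨w, by rw [this, hshift]⟩
  -- `ψ = φ − 1` on `ι 1 x` is `ι 1 (γ x − x)`
  have hψ : ∀ x : A, (φ - 1) (ι 1 x) = ι 1 (⟨γ x, hγA x x.2⟩ - x) := by
    intro x
    change φ (ι 1 x) - ι 1 x = _
    rw [map_sub, hequiv 1 x]
  have hfix : ∀ z : A, (φ - 1) (ι 1 z) = 0 → ∃ w ∈ A, γ z - z = p • w := by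
    intro z hz
    rw [hψ] at hz
    obtain ⟨w, hw⟩ := (hker1 _).1 hz
    exact ⟨w, w.2, by rw [← hw, AddSubgroup.coe_sub]⟩
  -- pairwise dependence of `S[𝔪]`
  have hdepS : ∀ s t : S, p • s = 0 → (φ - 1) s = 0 → p • t = 0 → (φ - 1) t = 0 →
      ∃ a b : ℤ, ¬ ((p : ℤ) ∣ a ∧ (p : ℤ) ∣ b) ∧ a • s + b • t = 0 := by
    intro s t hps hψs hpt hψt
    obtain ⟨x, rfl⟩ := hS1 s hps
    obtain ⟨y, rfl⟩ := hS1 t hpt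
    obtain ⟨a, b, hab, w, hw, hrel⟩ := hdep x x.2 y y.2 (hfix x hψs) (hfix y hψt)
    refine ⟨a, b, hab, ?_⟩
    have e : a • x + b • y = p • (⟨w, hw⟩ : A) :=
      Subtype.ext (by rw [AddSubgroup.coe_add, AddSubgroup.coe_zsmul, AddSubgroup.coe_zsmul, AddSubgroup.coe_nsmul]; exact hrel)
    rw [← map_zsmul, ← map_zsmul, ← map_add, e, map_nsmul, hp1]
  -- divisibility
  have hdiv : ∀ s : S, ∃ t : S, p • t = s := by
    intro s
    obtain ⟨k, x, rfl⟩ := hsurj s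
    exact ⟨ι (k + 1) x, hsucc k x⟩
  -- `S[p]` infinite
  have hinfS : {s : S | p • s = 0}.Infinite := by
    intro hfin
    apply hinf
    have hsec : ∀ s : {s : S | p • s = 0}, ∃ x : A, ι 1 x = s := fun s ↦ hS1 s s.2
    choose sec hsec using hsec
    haveI : Fintype {s : S | p • s = 0} := hfin.fintype
    refine ⟨Finset.univ.image (fun s ↦ ((sec s : A) : L)), fun x hx ↦ ?_⟩
    let s₀ : {s : S | p • s = 0} := ⟨ι 1 ⟨x, hx⟩, hp1 _⟩
    refine ⟨(sec s₀ : L), Finset.mem_image.mpr ⟨s₀, Finset.mem_univ _, rfl⟩, ?_⟩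
    have hdiff : ι 1 (⟨x, hx⟩ - sec s₀) = 0 := by rw [map_sub, hsec s₀, sub_self]
    obtain ⟨w, hw⟩ := (hker1 _).1 hdiff
    refine ⟨w, w.2, ?_⟩
    rw [AddSubgroup.coe_sub] at hw
    exact sub_eq_iff_eq_add'.mp hw
  exact nonempty_linearEquiv_of_pairwise_dep_of_divisible_of_infinite h hdepS hdiv hinfS

end Hull

end Summit.BirchSwinnertonDyer.BirchSwinnertonDyer.Theorems.ResidualThetaLayer.PlusDual

/-! ## §3 `K = ℚ`, `p = 2`: `(H⁺)^∨ ≅ Λ` for every realization of `(⋃ₙ E⁺(ℚ_{2,n})) ⊗ ℚ₂/ℤ₂`, unconditionally -/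

namespace Summit.BirchSwinnertonDyer.BirchSwinnertonDyer.Theorems.SignedEC.PlusDualTwo

open Literature.NumberTheory.GaloisRepresentations WeierstrassCurve ZpExtension
  Literature.NumberTheory.EllipticCurves.Kobayashi2003 Literature.NumberTheory.EllipticCurves.Sprung2012
  Summit.BirchSwinnertonDyer.Rank1Residual.Additive NumberField IsDedekindDomain

variable (W : WeierstrassCurve ℚ) [W.IsElliptic] [W.IsGloballyMinimal]

omit [W.IsElliptic] [W.IsGloballyMinimal] in
/-- `⋃ₙ E⁺(ℚ_{2,n})` is `Γ_{ℚ_v}`-stable. [cite: Kobayashi2003, Def. 1.1] -/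
theorem smul_mem_iSup_signedLocalPoints (κ : ZpExtension ℚ 2) (v : HeightOneSpectrum (𝓞 ℚ))
    (σ : Field.absoluteGaloisGroup (v.adicCompletion ℚ)) {x : localPoints W (v.adicCompletion ℚ)}
    (hx : x ∈ ⨆ n, signedLocalPoints κ (v.adicCompletion ℚ) W 1 n) :
    σ • x ∈ ⨆ n, signedLocalPoints κ (v.adicCompletion ℚ) W 1 n := by
  set ι := closureEmb (K := ℚ) (v.adicCompletion ℚ) with hι
  obtain ⟨n, hxn⟩ := (AddSubgroup.mem_iSup_of_directed (signedLocalPointsOfEmb_mono κ ι W 1).directed_le).1 hx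
  refine le_iSup (fun m ↦ signedLocalPoints κ (v.adicCompletion ℚ) W 1 m) n ?_
  change σ • x ∈ signedLocalPointsOfEmb κ ι W 1 n
  have hxn' : x ∈ signedLocalPointsOfEmb κ ι W 1 n := hxn
  rw [signedLocalPointsOfEmb_eq_towerSigned] at hxn' ⊢
  exact smul_mem_towerSignedLocalPointsOfEmb κ.layerSubgroup ι W 1 n σ hxn'

omit [W.IsElliptic] [W.IsGloballyMinimal] in
/-- `⋃ₙ E⁺(ℚ_{2,n}) ≤ E(ℚ_{2,∞}·ℚ_v)`. [cite: Kobayashi2003, Def. 1.1] -/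
theorem iSup_signedLocalPoints_le_localTowerPointsOfEmb (κ : ZpExtension ℚ 2) (v : HeightOneSpectrum (𝓞 ℚ)) :
    (⨆ n, signedLocalPoints κ (v.adicCompletion ℚ) W 1 n) ≤
      Sprung2012.localTowerPointsOfEmb κ (closureEmb (K := ℚ) (v.adicCompletion ℚ)) W := by
  refine iSup_le fun n x hx ↦ ?_
  exact Sprung2012.localLayerPointsOfEmb_le_localTowerPointsOfEmb κ _ W n
    (((mem_signedLocalPointsOfEmb_iff κ _ W 1 n x).1 hx).1)

/-- **`(H⁺)^∨ ≅ Λ` at `2` (B. D. Kim's Prop. 3.17 at the prime `2`), for every realization and every dual pair — UNCONDITIONAL.**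
Let `W/ℚ` be globally minimal with good supersingular reduction at `2` and `a₂(W) = 0`, `κ` the cyclotomic `ℤ₂`-extension, `v ∋ 2`,
`g ∈ Γ_{ℚ_v}` a local lift of the topological generator, `A = ⋃ₙ E⁺(ℚ_{2,n})` (Kobayashi's plus points on the tower). Let
`(S, φ)` be ANY realization of `A ⊗ ℚ₂/ℤ₂` with its `g`-action — additive `ι k : A → S` («`x ⊗ 2^{-k}`») with `ι 0 = 0`,
`2·ι (k+1) = ι k`, `S = ⋃ₖ im ι k`, `ι k x = 0 ⟹ x ∈ 2^k A`, `φ ∘ ι k = ι k ∘ g` — and `(X, toDual)` ANY dual pair of `(S, φ − 1)`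
(`IwasawaDual.IsDualPair`). Then `X ≃ₗ[ℤ₂⟦T⟧] ℤ₂⟦T⟧`. Inputs: `PlusModP.plusFixedModTwo_dep_iSup_two` (CYC⁺ ⟹ `#(A/2A)^γ ≤ 2`),
`PlusRankGrowth.not_exists_finset_cover_mod_two` (`Col⁺` onto ⟹ `A/2A` infinite), `PlusDual.nonempty_linearEquiv_of_hull`.
[cite: BDKim2007, Prop. 3.17] [cite: BDKim2013, Props. 2.2–2.3] [cite: Kobayashi2003, Thm. 6.2, Prop. 8.12, Prop. 8.23] -/
theorem nonempty_linearEquiv_iwasawaAlgebra_two (hss : Rank1Residual.GoodSS W 2) (ha : W.frobeniusTrace 2 = 0)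
    {κ : ZpExtension ℚ 2} (hκ : κ.IsCyclotomic) (v : HeightOneSpectrum (𝓞 ℚ)) (hv : (2 : 𝓞 ℚ) ∈ v.asIdeal)
    {g : Field.absoluteGaloisGroup (v.adicCompletion ℚ)}
    (hg : κ.IsTopGenerator (resGalOfEmb (closureEmb (K := ℚ) (v.adicCompletion ℚ)) g))
    {S : Type*} [AddCommGroup S] {φ : AddMonoid.End S}
    {X : Type*} [AddCommGroup X] [Module (PowerSeries ℤ_[2]) X] {toDual : X →+ (S →+ AddCircle (1 : ℚ))}
    (h : Literature.NumberTheory.EllipticCurves.IwasawaDual.IsDualPair 2 (φ - 1) toDual)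
    (ι : ℕ → (↥(⨆ n, signedLocalPoints κ (v.adicCompletion ℚ) W 1 n) →+ S))
    (h0 : ∀ x, ι 0 x = 0) (hsucc : ∀ (k : ℕ) x, 2 • ι (k + 1) x = ι k x)
    (hsurj : ∀ s : S, ∃ (k : ℕ) (x : ↥(⨆ n, signedLocalPoints κ (v.adicCompletion ℚ) W 1 n)), ι k x = s)
    (hker : ∀ (k : ℕ) (x : ↥(⨆ n, signedLocalPoints κ (v.adicCompletion ℚ) W 1 n)), ι k x = 0 →
      ∃ w : ↥(⨆ n, signedLocalPoints κ (v.adicCompletion ℚ) W 1 n),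
        (x : localPoints W (v.adicCompletion ℚ)) = 2 ^ k • (w : localPoints W (v.adicCompletion ℚ)))
    (hequiv : ∀ (k : ℕ) (x : ↥(⨆ n, signedLocalPoints κ (v.adicCompletion ℚ) W 1 n)),
      φ (ι k x) = ι k ⟨g • (x : localPoints W (v.adicCompletion ℚ)), smul_mem_iSup_signedLocalPoints W κ v g x.2⟩) :
    Nonempty (X ≃ₗ[PowerSeries ℤ_[2]] PowerSeries ℤ_[2]) := by
  refine ResidualThetaLayer.PlusDual.nonempty_linearEquiv_of_hull (γ := fun x ↦ g • x) h
    (fun x hx ↦ smul_mem_iSup_signedLocalPoints W κ v g hx) ι h0 hsucc hsurj hker hequiv ?_ ?_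
  · exact PlusModP.plusFixedModTwo_dep_iSup_two W hss ha hκ v hv hg
  · rintro ⟨F, hF⟩
    refine PlusRankGrowth.not_exists_finset_cover_mod_two W hss ha κ hκ v hv ⟨F, fun x hx ↦ ?_⟩
    obtain ⟨r, hr, w, hw, hxe⟩ := hF x hx
    exact ⟨r, hr, w, iSup_signedLocalPoints_le_localTowerPointsOfEmb W κ v hw, hxe⟩

end Summit.BirchSwinnertonDyer.BirchSwinnertonDyer.Theorems.SignedEC.PlusDualTwo

end
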